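import Summits.BirchSwinnertonDyer.Rank1Residual.X11b.KummerLocalTorsionSaturation
import Summits.BirchSwinnertonDyer.Rank1Residual.X11b.PropagatedUnramified
import Literature.NumberTheory.EllipticCurves.CasselsTateLemma615
import Literature.NumberTheory.EllipticCurves.HasseWeilGoodReduction
import HarnessLib

/-!
# X11b, routes R1/p2 — the Kummer Selmer structure of `E[n]` RELAXED / made STRICT on a finite set
# of places, and its unramifiedness outside `S' ∪ ∞ ∪ {v ∣ p} ∪ {bad}` (input shapes of Howard 2.1.11)

HONEST FRAMING (cell `b2b-bsdres`, run/shared/lean/b2b/bsd-rank1-residual/, verbatim in every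
file): the goal of the cell is to DELETE the COMBINATION-SHAPED residual classes of the
Birch–Swinnerton-Dyer formula for ALL analytic-rank `≤ 1` elliptic curves over `ℚ` — "full BSD
formula for every rank `≤ 1` curve in class `C`" assembled STRICTLY from published theorems — so
that the rank-`≤ 1` remainder becomes exactly the CONSTRUCTION-SHAPED classes, which are TYPED
(missing-input `Prop`s), NOT attempted. This is not "finishing BSD". Sub-cell
`b2b-bsdres-multr1-p1` (X11b, route R1 = Castella 2018 Thm. A re-proved along the author's
erratum); a RESEARCH ROUTE; no claim beyond the stated class; X11b stays CONSTRUCTION-SHAPED;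
nothing here changes a label; no named fact is minted (two definitions with bodies — the Kummer
Selmer structure made `⊤`, resp. `⊥`, on a finite set of places: plumbing, nothing asserted — and
theorems; no `sorry`).

## What is here (plumbing for `KummerPoitouTateExact`: Poitou–Tate exactness for the Kummer structure)

The tree's cited Poitou–Tate fact (`poitouTate_selmerStructure_duality`, Howard 2004 Thm. 2.1.11
`SelmerComplement`) is stated for a pair of Selmer structures `𝓕 ≤ 𝓖` on a finite module that are
`IsUnramifiedOutside S`.  To apply it to `H¹(G_S, E[n])` in the Kummer presentation
(`kummerOutside W n S'`, `CasselsTateLemma615`) one needs the Kummer structure of `E[n]`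
(`WeierstrassCurve.kummerSelmerStructure`) with the conditions on `S'` replaced by `⊤` / `⊥`:

* `kummerRelaxed W n S'` (`⊤` on `S'`, `𝓛_v = im κ_v` elsewhere), `kummerStrict W n S'` (`⊥` on
  `S'`); `kummerStrict ≤ kummerRelaxed`; **`selmerGroup_kummerRelaxed`:
  `H¹_{kummerRelaxed S'}(K, E[n]) = kummerOutside W n S'`**;
* **`kummerSelmerStructure_inr_eq_unramifiedSubgroup`**: at a good finite `v ∤ p` the local Kummer
  condition of `E[p^k]` IS `H¹_ur(K_v, E[p^k])` (Silverman X.4.4 / Milne I 3.8 at the completion) —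
  the tree's `kummerLocalConditionAt_eq_ker_map_primaryInclusion` (multr1-p2 gen 19) composed with
  `ker_map_primaryInclusion_restrictField_eq_unramifiedSubgroup` (multr1-p1 gen 14);
* hence `kummerRelaxed_isUnramifiedOutside`, `kummerStrict_isUnramifiedOutside` for every finite
  `T ⊇ S' ∪ ∞ ∪ {v ∣ p} ∪ {bad}`, and `exists_exceptional_finset` (such a `T` exists:
  `eventually_hasGoodReductionAt`, `Ideal.finite_factors`).

References: [Howard2004HeegnerKolyvagin] Def. 2.1.1, Def. 2.1.10, Thm. 2.1.11 (arXiv:1202.6340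
pp. 5–6); [MilneADT2006] I §6 (6.5), Lemma 6.15, Prop. 3.8; [SilvermanAEC2009] Cor. X.4.4, Rem. VIII.1.3.
-/

noncomputable section

open scoped Classical

open CategoryTheory Field NumberField IsDedekindDomain Function
open Literature.NumberTheory.EllipticCurves Literature.NumberTheory.EllipticCurves.GreenbergSelmer
open Literature.NumberTheory.GaloisRepresentations
open Literature.NumberTheory.GaloisRepresentations.DiscreteGaloisModule (SelmerStructure unramifiedSubgroup)
open Literature.NumberTheory.GaloisCohomology
open scoped ContRepresentation

namespace Summit.BirchSwinnertonDyer.Rank1Residual.X11b.KummerPT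

open Summit.BirchSwinnertonDyer.Rank1Residual.X11b.LocBridge
open Summit.BirchSwinnertonDyer.Rank1Residual.X11b.Levels
open Summit.BirchSwinnertonDyer.Rank1Residual.X11b.AcSelmer

variable {K : Type} [Field K] [NumberField K] (W : WeierstrassCurve K) [W.IsElliptic] (p k : ℕ)
  [Fact p.Prime]

/-! ## §1. The Kummer structure relaxed / made strict on a finite set of places -/

section Structures

variable (n : ℕ) (S' : Finset (Place K))

/-- **`kummerRelaxed S'`**: the Kummer Selmer structure of `E[n]` (`𝓛_v = im κ_v` at every
place) made `⊤` (no condition) on the finite set `S'`; its Selmer group is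
`kummerOutside W n S'` (`selmerGroup_kummerRelaxed`). A definition; nothing asserted.
[cite: MilneADT2006, Ch. I §6, (6.5) and Lemma 6.15] -/
def kummerRelaxed : SelmerStructure (W.torsionGaloisModule (n : ℤ)) := fun v ↦
  if v ∈ S' then ⊤ else W.kummerSelmerStructure (n : ℤ) v

/-- **`kummerStrict S'`**: the Kummer Selmer structure of `E[n]` made `⊥` (strict) on `S'`.
A definition; nothing asserted. [cite: Howard2004HeegnerKolyvagin, Def. 2.1.1 (arXiv:1202.6340 p. 5)] -/
def kummerStrict : SelmerStructure (W.torsionGaloisModule (n : ℤ)) := fun v ↦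
  if v ∈ S' then ⊥ else W.kummerSelmerStructure (n : ℤ) v

omit [W.IsElliptic] [Fact p.Prime] in
/-- `kummerRelaxed S' = ⊤` on `S'`. [folklore] -/
theorem kummerRelaxed_of_mem {v : Place K} (hv : v ∈ S') : kummerRelaxed W n S' v = ⊤ := by
  unfold kummerRelaxed; rw [if_pos hv]

omit [W.IsElliptic] [Fact p.Prime] in
/-- `kummerRelaxed S'` is the Kummer condition off `S'`. [folklore] -/
theorem kummerRelaxed_of_not_mem {v : Place K} (hv : v ∉ S') :
    kummerRelaxed W n S' v = W.kummerSelmerStructure (n : ℤ) v := by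
  unfold kummerRelaxed; rw [if_neg hv]

omit [W.IsElliptic] [Fact p.Prime] in
/-- `kummerStrict S' = ⊥` on `S'`. [folklore] -/
theorem kummerStrict_of_mem {v : Place K} (hv : v ∈ S') : kummerStrict W n S' v = ⊥ := by
  unfold kummerStrict; rw [if_pos hv]

omit [W.IsElliptic] [Fact p.Prime] in
/-- `kummerStrict S'` is the Kummer condition off `S'`. [folklore] -/
theorem kummerStrict_of_not_mem {v : Place K} (hv : v ∉ S') :
    kummerStrict W n S' v = W.kummerSelmerStructure (n : ℤ) v := by
  unfold kummerStrict; rw [if_neg hv]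

omit [W.IsElliptic] [Fact p.Prime] in
/-- **`kummerStrict S' ≤ kummerRelaxed S'`** (the pair `𝓕 ≤ 𝓖` of Howard Thm. 2.1.11 used here).
[cite: Howard2004HeegnerKolyvagin, Thm. 2.1.11 (arXiv:1202.6340 p. 6)] -/
theorem kummerStrict_le_kummerRelaxed : kummerStrict W n S' ≤ kummerRelaxed W n S' := by
  intro v
  by_cases hv : v ∈ S'
  · rw [kummerStrict_of_mem W n S' hv]; exact bot_le
  · rw [kummerStrict_of_not_mem W n S' hv, kummerRelaxed_of_not_mem W n S' hv]

omit [W.IsElliptic] [Fact p.Prime] in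
/-- **`H¹_{kummerRelaxed S'}(K, E[n]) = kummerOutside W n S'`** (the tree's "`H¹(G_S, E[m])` in
the Kummer presentation", `CasselsTateLemma615`). [cite: MilneADT2006, Ch. I §6, (6.5) and Lemma 6.15] -/
theorem selmerGroup_kummerRelaxed :
    (kummerRelaxed W n S').selmerGroup = kummerOutside W n S' := by
  ext c
  rw [SelmerStructure.mem_selmerGroup_iff, mem_kummerOutside_iff]
  constructor
  · intro h v hv
    have h' := h v
    rw [kummerRelaxed_of_not_mem W n S' hv, WeierstrassCurve.kummerSelmerStructure_apply] at h'
    exact h'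
  · intro h v
    by_cases hv : v ∈ S'
    · rw [kummerRelaxed_of_mem W n S' hv]; exact AddSubgroup.mem_top _
    · rw [kummerRelaxed_of_not_mem W n S' hv, WeierstrassCurve.kummerSelmerStructure_apply]
      exact h v hv

/-- **At a good finite `v ∤ p` the local Kummer condition of `E[p^k]` IS `H¹_ur(K_v, E[p^k])`**
(Silverman X.4.4 / Milne I Prop. 3.8, at the completion): the tree's
`kummerLocalConditionAt_eq_ker_map_primaryInclusion` (Kummer = classes dying in `H¹(K_v, E[p^∞])`,
`v ∤ p`) composed with `ker_map_primaryInclusion_restrictField_eq_unramifiedSubgroup` (that kernel is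
`H¹_ur` at good `v ∤ p`). [cite: SilvermanAEC2009, Cor. X.4.4] [cite: MilneADT2006, Ch. I Prop. 3.8] -/
theorem kummerSelmerStructure_inr_eq_unramifiedSubgroup {v : HeightOneSpectrum (𝓞 K)}
    (hpv : ((p : ℕ) : 𝓞 K) ∉ v.asIdeal) (hv : W.HasGoodReductionAt v) :
    W.kummerSelmerStructure ((p ^ k : ℕ) : ℤ) (Sum.inr v) =
      unramifiedSubgroup (GaloisRep.toLocal v (W.torsionGaloisModule ((p ^ k : ℕ) : ℤ))) 1 := by
  have hn : ((p ^ k : ℕ) : ℤ) ≠ 0 := by exact_mod_cast pow_ne_zero k (Fact.out : p.Prime).ne_zero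
  rw [WeierstrassCurve.kummerSelmerStructure_apply]
  change W.kummerLocalConditionAt ((p ^ k : ℕ) : ℤ) (v.adicCompletion K) = _
  rw [LevelKummer.kummerLocalConditionAt_eq_ker_map_primaryInclusion W p k v hpv hn]
  exact ker_map_primaryInclusion_restrictField_eq_unramifiedSubgroup W p k hpv hv

/-- **`kummerRelaxed S'` on `E[p^k]` is unramified outside every finite `T ⊇ S' ∪ ∞ ∪ {v ∣ p} ∪ {bad}`**
(Howard Def. 2.1.10). [cite: Howard2004HeegnerKolyvagin, Def. 2.1.10 (arXiv:1202.6340 p. 6)] -/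
theorem kummerRelaxed_isUnramifiedOutside (T : Finset (Place K)) (hS'T : S' ⊆ T)
    (hinf : ∀ w : InfinitePlace K, (Sum.inl w : Place K) ∈ T)
    (hp : ∀ v : HeightOneSpectrum (𝓞 K), ((p : ℕ) : 𝓞 K) ∈ v.asIdeal → (Sum.inr v : Place K) ∈ T)
    (hbad : ∀ v : HeightOneSpectrum (𝓞 K), ¬ W.HasGoodReductionAt v → (Sum.inr v : Place K) ∈ T) :
    SelmerStructure.IsUnramifiedOutside (kummerRelaxed W (p ^ k) S') T := by
  refine ⟨hinf, fun v hv ↦ ?_⟩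
  have hpv : ((p : ℕ) : 𝓞 K) ∉ v.asIdeal := fun h ↦ hv (hp v h)
  have hgood : W.HasGoodReductionAt v := by
    by_contra h
    exact hv (hbad v h)
  rw [kummerRelaxed_of_not_mem W (p ^ k) S' (fun h ↦ hv (hS'T h))]
  exact kummerSelmerStructure_inr_eq_unramifiedSubgroup W p k hpv hgood

/-- **`kummerStrict S'` on `E[p^k]` is unramified outside every finite `T ⊇ S' ∪ ∞ ∪ {v ∣ p} ∪ {bad}`.**
[cite: Howard2004HeegnerKolyvagin, Def. 2.1.10 (arXiv:1202.6340 p. 6)] -/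
theorem kummerStrict_isUnramifiedOutside (T : Finset (Place K)) (hS'T : S' ⊆ T)
    (hinf : ∀ w : InfinitePlace K, (Sum.inl w : Place K) ∈ T)
    (hp : ∀ v : HeightOneSpectrum (𝓞 K), ((p : ℕ) : 𝓞 K) ∈ v.asIdeal → (Sum.inr v : Place K) ∈ T)
    (hbad : ∀ v : HeightOneSpectrum (𝓞 K), ¬ W.HasGoodReductionAt v → (Sum.inr v : Place K) ∈ T) :
    SelmerStructure.IsUnramifiedOutside (kummerStrict W (p ^ k) S') T := by
  refine ⟨hinf, fun v hv ↦ ?_⟩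
  have hpv : ((p : ℕ) : 𝓞 K) ∉ v.asIdeal := fun h ↦ hv (hp v h)
  have hgood : W.HasGoodReductionAt v := by
    by_contra h
    exact hv (hbad v h)
  rw [kummerStrict_of_not_mem W (p ^ k) S' (fun h ↦ hv (hS'T h))]
  exact kummerSelmerStructure_inr_eq_unramifiedSubgroup W p k hpv hgood

/-- **A finite exceptional set exists**: a finite set of places `T ⊇ S' ∪ ∞ ∪ {v ∣ p} ∪ {bad}`
(infinite places: finitely many; places above `p`: `Ideal.finite_factors`; bad places:
`eventually_hasGoodReductionAt`, Silverman VIII.1.3). [cite: SilvermanAEC2009, Rem. VIII.1.3] -/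
theorem exists_exceptional_finset :
    ∃ T : Finset (Place K), S' ⊆ T ∧ (∀ w : InfinitePlace K, (Sum.inl w : Place K) ∈ T) ∧
      (∀ v : HeightOneSpectrum (𝓞 K), ((p : ℕ) : 𝓞 K) ∈ v.asIdeal → (Sum.inr v : Place K) ∈ T) ∧
      (∀ v : HeightOneSpectrum (𝓞 K), ¬ W.HasGoodReductionAt v → (Sum.inr v : Place K) ∈ T) := by
  have hbadfin : {v : HeightOneSpectrum (𝓞 K) | ¬ W.HasGoodReductionAt v}.Finite := by
    have h := W.eventually_hasGoodReductionAt
    rwa [Filter.eventually_cofinite] at h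
  have hp0 : (Ideal.span {((p : ℕ) : 𝓞 K)} : Ideal (𝓞 K)) ≠ 0 := by
    rw [Ne, Ideal.zero_eq_bot, Ideal.span_singleton_eq_bot]
    exact_mod_cast (Fact.out : p.Prime).ne_zero
  have hpfin : {v : HeightOneSpectrum (𝓞 K) | ((p : ℕ) : 𝓞 K) ∈ v.asIdeal}.Finite := by
    refine (Ideal.finite_factors hp0).subset fun v hv ↦ ?_
    exact (Ideal.dvd_span_singleton).mpr hv
  refine ⟨S' ∪ (Finset.univ.image Sum.inl) ∪ (hpfin.toFinset.image Sum.inr) ∪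
    (hbadfin.toFinset.image Sum.inr), ?_, ?_, ?_, ?_⟩
  · intro v hv
    simp only [Finset.mem_union]
    exact Or.inl (Or.inl (Or.inl hv))
  · intro w
    simp only [Finset.mem_union, Finset.mem_image, Finset.mem_univ, true_and]
    exact Or.inl (Or.inl (Or.inr ⟨w, rfl⟩))
  · intro v hv
    simp only [Finset.mem_union, Finset.mem_image, Set.Finite.mem_toFinset, Set.mem_setOf_eq]
    exact Or.inl (Or.inr ⟨v, hv, rfl⟩)
  · intro v hv
    simp only [Finset.mem_union, Finset.mem_image, Set.Finite.mem_toFinset, Set.mem_setOf_eq]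
    exact Or.inr ⟨v, hv, rfl⟩

end Structures

end Summit.BirchSwinnertonDyer.Rank1Residual.X11b.KummerPT

end
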